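import Mathlib
import HarnessLib
import Literature.MathematicalPhysics.QuantumLattice.KohnLuttinger
import Literature.MathematicalPhysics.QuantumLattice.KohnLuttingerChannelStates
import Literature.MathematicalPhysics.QuantumLattice.KohnLuttingerLindhardMeasurable
import Summits.HubbardSuperconductivity.HubbardSuperconductivity.Theorems.WeakCouplingBCSWcbcsKohnLuttingerB1gReduction
import Summits.HubbardSuperconductivity.HubbardSuperconductivity.Theorems.WeakCouplingBCSWcbcsKohnLuttingerB1gKlCertForm
import Summits.HubbardSuperconductivity.HubbardSuperconductivity.Theorems.WeakCouplingBCSKlCertTPrimePHReflection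
import Summits.HubbardSuperconductivity.HubbardSuperconductivity.Theorems.ChiralWindowCwChannelInfContinuousL2
import Summits.HubbardSuperconductivity.HubbardSuperconductivity.Theorems.ChiralWindowCwKLChiralWindowD4Invariant
import Summits.HubbardSuperconductivity.HubbardSuperconductivity.Theorems.WeakCouplingBCSKlSublatticeChannelLe

/-!
# The deck shift of the pure `t'` band and the deck-odd part of a gap function («(KLSCAN)-SUBLATTICE-DUALITY-DISCHARGE»
# part 7; cell gate-hubbard-kl, seat p4 g20)

The pure next-nearest-neighbour band `ε' = squareDispersion 0 1` is `(π, π)`-periodic, so the folded shift `D = klphShift`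
(seat p4 g19's particle–hole shift, here a genuine SYMMETRY — the deck transformation of the sublattice cover `Φ`, `Φ ∘ D = Φ`):

* §14 `ε' ∘ D = ε'` on the zone, `D⁻¹ F' = F'`, `∇ε' ∘ D = ∇ε'`, **`klsl_measurePreserving_shift_nnn`: `D_* σ' = σ'`**,
  `Γ'(k, D k') = Γ'(k, k')` (the Lindhard function of `ε'` is `(±π, ±π)`-periodic), the four exceptional lines are `σ'`-null
  (`klsl_ae_mem_klphGood_nnn`), `klphGood` is `D`-invariant, and `f ∈ χ ⇒ 𝟙_G · (f ∘ D) ∈ χ` (`klsl_inChannel_shift`);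
* §15 **`klsl_integral_kernel_odd`**: the kernel annihilates deck-odd functions (`∫ Γ'(k,k') g(k') dσ' = 0` for every `k` if
  `g ∘ D = -g` a.e.), the bilinear Fubini identity, and **`klsl_pairingForm_even_odd`**: `⟨e + o, Γ'(e + o)⟩ = ⟨e, Γ' e⟩`
  for `e, o ∈ L²(σ')`, `o` deck-odd (`μ ∈ (-4, 0)`; Hilbert–Schmidt frame).

Honest framing: exact symmetry bookkeeping for a free band; nothing asserts a margin, the window, `K₃` or superconductivity.
-/

noncomputable section

set_option linter.dupNamespace false

namespace Summit.HubbardSuperconductivity.HubbardSuperconductivity.Theorems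

open MeasureTheory Real Set Literature.MathematicalPhysics.QuantumLattice
open scoped ENNReal Pointwise

/-! ### §14 The deck shift `D = klphShift` is a symmetry of the pure `t'` band -/

/-- **The pure `t'` band is `(π, π)`-periodic on the zone**: `ε'(D k) = ε'(k)` for `k ∈ BZ` (`D` = g19's folded shift by
`(π, π)`; both cosines flip sign). [folklore] -/
theorem klsl_squareDispersion_nnn_shift {k : Momentum} (hk : k ∈ brillouinZone) :
    squareDispersion 0 1 (klphShift k) = squareDispersion 0 1 k := by
  simp only [squareDispersion, klphShift_apply_zero, klphShift_apply_one, cos_klphTau (hk 0), cos_klphTau (hk 1)]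
  ring

/-- `D ⁻¹' F' = F'` for the Fermi curve `F'` of the pure `t'` band. [folklore] -/
theorem klsl_shift_preimage_fermiCurve_nnn (μ : ℝ) :
    klphShift ⁻¹' fermiCurve (squareDispersion 0 1) μ = fermiCurve (squareDispersion 0 1) μ := by
  ext k
  simp only [mem_preimage, fermiCurve, mem_setOf_eq, klphShift_mem_brillouinZone_iff]
  constructor
  · rintro ⟨hk, h⟩; exact ⟨hk, by rwa [klsl_squareDispersion_nnn_shift hk] at h⟩
  · rintro ⟨hk, h⟩; exact ⟨hk, by rwa [klsl_squareDispersion_nnn_shift hk]⟩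

/-- The Fermi velocity of the pure `t'` band is `D`-invariant on the zone. [folklore] -/
theorem klsl_gradient_nnn_shift {k : Momentum} (hk : k ∈ brillouinZone) :
    gradient (squareDispersion 0 1) (klphShift k) = gradient (squareDispersion 0 1) k := by
  rw [klsl_gradient_squareDispersion, klsl_gradient_squareDispersion]
  ext i
  fin_cases i <;> simp [sin_klphTau (hk 0), sin_klphTau (hk 1), cos_klphTau (hk 0), cos_klphTau (hk 1)]

/-- `D` preserves arc length on the Fermi curve of the pure `t'` band. [folklore] -/
theorem klsl_measurePreserving_shift_hausdorff_nnn (μ : ℝ) :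
    MeasurePreserving klphShift
      ((μH[1] : Measure Momentum).restrict (fermiCurve (squareDispersion 0 1) μ))
      ((μH[1] : Measure Momentum).restrict (fermiCurve (squareDispersion 0 1) μ)) := by
  refine ⟨klph_measurable_shift, Measure.ext fun A hA => ?_⟩
  rw [Measure.map_apply klph_measurable_shift hA, Measure.restrict_apply (klph_measurable_shift hA),
    Measure.restrict_apply hA]
  conv_lhs => rw [← klsl_shift_preimage_fermiCurve_nnn μ, ← preimage_inter, klphShift_preimage_eq_image]
  exact klph_hausdorffMeasure_image_shift (fun k hk => hk.2.1)

/-- **`D` preserves the Fermi-curve measure of the pure `t'` band**: `D_* σ' = σ'`. [folklore] -/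
theorem klsl_measurePreserving_shift_nnn (μ : ℝ) :
    MeasurePreserving klphShift (fermiCurveMeasure (squareDispersion 0 1) μ) (fermiCurveMeasure (squareDispersion 0 1) μ) := by
  refine ⟨klph_measurable_shift, ?_⟩
  have hmp := klsl_measurePreserving_shift_hausdorff_nnn μ
  have hF := measurableSet_fermiCurve (measurable_squareDispersion 0 1) μ
  have hae : (fun k => ENNReal.ofReal (‖gradient (squareDispersion 0 1) k‖⁻¹)) =ᵐ[(μH[1] : Measure Momentum).restrict
      (fermiCurve (squareDispersion 0 1) μ)] (fun k => ENNReal.ofReal (‖gradient (squareDispersion 0 1) k‖⁻¹)) ∘ klphShift := by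
    filter_upwards [ae_restrict_mem hF] with k hk
    simp only [Function.comp_apply, klsl_gradient_nnn_shift hk.1]
  unfold fermiCurveMeasure
  conv_lhs => rw [withDensity_congr_ae hae]
  exact klph_map_withDensity_comp_equiv klphShiftEquiv hmp _

/-- The Lindhard function of the pure `t'` band is `(±π, ±π)`-periodic in the transfer. [folklore] -/
theorem klsl_lindhardFunction_nnn_add_halfvec (μ : ℝ) (q : Momentum) {a b : ℝ} (ha : a = π ∨ a = -π)
    (hb : b = π ∨ b = -π) :
    lindhardFunction (squareDispersion 0 1) μ (q + klslVec a b) = lindhardFunction (squareDispersion 0 1) μ q := by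
  refine klph_lindhardFunction_congr μ fun p => ?_
  have h0 : cos ((p + (q + klslVec a b)) 0) = -cos ((p + q) 0) := by
    simp only [PiLp.add_apply, klslVec_apply_zero, ← add_assoc]
    rcases ha with rfl | rfl
    · rw [cos_add_pi]
    · rw [show p 0 + q 0 + -π = (p 0 + q 0) - π by ring, cos_sub_pi]
  have h1 : cos ((p + (q + klslVec a b)) 1) = -cos ((p + q) 1) := by
    simp only [PiLp.add_apply, klslVec_apply_one, ← add_assoc]
    rcases hb with rfl | rfl
    · rw [cos_add_pi]
    · rw [show p 1 + q 1 + -π = (p 1 + q 1) - π by ring, cos_sub_pi]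
  simp only [squareDispersion, h0, h1]
  ring

/-- `D k = k + (±π, ±π)` on the zone. [folklore] -/
theorem klsl_shift_eq_add_halfvec {k : Momentum} (hk : k ∈ brillouinZone) :
    ∃ a b : ℝ, (a = π ∨ a = -π) ∧ (b = π ∨ b = -π) ∧ klphShift k = k + klslVec a b := by
  have h0 := klphTau_eq_add_pi_or (hk 0)
  have h1 := klphTau_eq_add_pi_or (hk 1)
  refine ⟨klphTau (k 0) - k 0, klphTau (k 1) - k 1, ?_, ?_, ?_⟩
  · rcases h0 with h | h
    · exact Or.inl (by rw [h]; ring)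
    · exact Or.inr (by rw [h]; ring)
  · rcases h1 with h | h
    · exact Or.inl (by rw [h]; ring)
    · exact Or.inr (by rw [h]; ring)
  · ext i; fin_cases i <;> simp

/-- **The kernel of the pure `t'` band does not see the deck shift**: `Γ'(k, D k') = Γ'(k, k')` for `k' ∈ BZ`. [folklore] -/
theorem klsl_kernel_nnn_shift_right (μ U : ℝ) (k : Momentum) {k' : Momentum} (hk' : k' ∈ brillouinZone) :
    kohnLuttingerKernel (squareDispersion 0 1) μ U k (klphShift k') = kohnLuttingerKernel (squareDispersion 0 1) μ U k k' := by
  obtain ⟨a, b, ha, hb, h⟩ := klsl_shift_eq_add_halfvec hk'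
  rw [kohnLuttingerKernel, kohnLuttingerKernel, h, ← add_assoc, klsl_lindhardFunction_nnn_add_halfvec μ _ ha hb]

/-- The lines `k₀ = c`, `c ∈ {0, -π}`, carry no Fermi-curve measure of the pure `t'` band (they meet `F'` in countably many
points). [folklore] -/
theorem klsl_fermiCurveMeasure_nnn_line_fst (μ c : ℝ) (hc : c = 0 ∨ c = -π) :
    fermiCurveMeasure (squareDispersion 0 1) μ {k : Momentum | k 0 = c} = 0 := by
  have hcos : cos c ≠ 0 := by rcases hc with rfl | rfl <;> simp
  have hL : MeasurableSet {k : Momentum | k 0 = c} := klsl_measurable_fst (measurableSet_singleton c)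
  refine klph_fermiCurveMeasure_null_of_countable_or_gradient (measurable_squareDispersion 0 1) μ hL (Or.inl ?_)
  set d : ℝ := -μ / (4 * cos c) with hd
  have hsub : {k : Momentum | k 0 = c} ∩ fermiCurve (squareDispersion 0 1) μ ⊆
      (fun y : ℝ => (WithLp.toLp 2 ![c, y] : Momentum)) '' {y : ℝ | cos y = d} := by
    rintro k ⟨hk0, hkF⟩
    have hk0' : k 0 = c := hk0
    have hε : squareDispersion 0 1 k = μ := hkF.2
    refine ⟨k 1, ?_, ?_⟩
    · simp only [mem_setOf_eq, hd]
      rw [eq_div_iff (mul_ne_zero (by norm_num) hcos)]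
      simp only [squareDispersion, hk0'] at hε
      linarith
    · ext i; fin_cases i <;> simp [hk0']
  exact ((countable_setOf_cos_eq d).image _).mono hsub

/-- The same for the lines `k₁ = c`, `c ∈ {0, -π}`. [folklore] -/
theorem klsl_fermiCurveMeasure_nnn_line_snd (μ c : ℝ) (hc : c = 0 ∨ c = -π) :
    fermiCurveMeasure (squareDispersion 0 1) μ {k : Momentum | k 1 = c} = 0 := by
  have hcos : cos c ≠ 0 := by rcases hc with rfl | rfl <;> simp
  have hL : MeasurableSet {k : Momentum | k 1 = c} := klsl_measurable_snd (measurableSet_singleton c)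
  refine klph_fermiCurveMeasure_null_of_countable_or_gradient (measurable_squareDispersion 0 1) μ hL (Or.inl ?_)
  set d : ℝ := -μ / (4 * cos c) with hd
  have hsub : {k : Momentum | k 1 = c} ∩ fermiCurve (squareDispersion 0 1) μ ⊆
      (fun y : ℝ => (WithLp.toLp 2 ![y, c] : Momentum)) '' {y : ℝ | cos y = d} := by
    rintro k ⟨hk1, hkF⟩
    have hk1' : k 1 = c := hk1
    have hε : squareDispersion 0 1 k = μ := hkF.2
    refine ⟨k 0, ?_, ?_⟩
    · simp only [mem_setOf_eq, hd]
      rw [eq_div_iff (mul_ne_zero (by norm_num) hcos)]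
      simp only [squareDispersion, hk1'] at hε
      linarith
    · ext i; fin_cases i <;> simp [hk1']
  exact ((countable_setOf_cos_eq d).image _).mono hsub

/-- g19's good set `klphGood` (no coordinate in `{0, ±π}`) has full Fermi-curve measure for the pure `t'` band. [folklore] -/
theorem klsl_ae_mem_klphGood_nnn (μ : ℝ) : ∀ᵐ k ∂fermiCurveMeasure (squareDispersion 0 1) μ, k ∈ klphGood := by
  have hF := ae_mem_fermiCurve (measurable_squareDispersion 0 1) μ
  have l1 := measure_eq_zero_iff_ae_notMem.1 (klsl_fermiCurveMeasure_nnn_line_fst μ 0 (Or.inl rfl))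
  have l2 := measure_eq_zero_iff_ae_notMem.1 (klsl_fermiCurveMeasure_nnn_line_fst μ (-π) (Or.inr rfl))
  have l3 := measure_eq_zero_iff_ae_notMem.1 (klsl_fermiCurveMeasure_nnn_line_snd μ 0 (Or.inl rfl))
  have l4 := measure_eq_zero_iff_ae_notMem.1 (klsl_fermiCurveMeasure_nnn_line_snd μ (-π) (Or.inr rfl))
  filter_upwards [hF, l1, l2, l3, l4] with k hk h1 h2 h3 h4
  have hk0 : k 0 ∈ Ico (-π) π := hk.1 0
  have hk1 : k 1 ∈ Ico (-π) π := hk.1 1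
  have h1' : k 0 ≠ 0 := h1
  have h2' : k 0 ≠ -π := h2
  have h3' : k 1 ≠ 0 := h3
  have h4' : k 1 ≠ -π := h4
  rw [klphGood, mem_setOf_eq, Fin.forall_fin_two]
  exact ⟨⟨abs_pos.2 h1', abs_lt.2 ⟨lt_of_le_of_ne hk0.1 (Ne.symm h2'), hk0.2⟩⟩,
    ⟨abs_pos.2 h3', abs_lt.2 ⟨lt_of_le_of_ne hk1.1 (Ne.symm h4'), hk1.2⟩⟩⟩

/-- The good set is invariant under the deck shift. [folklore] -/
theorem klsl_klphShift_mem_klphGood {k : Momentum} (hk : k ∈ klphGood) : klphShift k ∈ klphGood := by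
  intro i
  have h := hk i
  have habs := abs_lt.1 h.2
  have hne : k i ≠ 0 := abs_pos.1 h.1
  rw [klphShift_apply]
  rcases lt_or_gt_of_ne hne with hneg | hpos
  · rw [klphTau_of_mem_left ⟨habs.1.le, hneg⟩]
    exact ⟨abs_pos.2 (by linarith), abs_lt.2 ⟨by linarith, by linarith⟩⟩
  · rw [klphTau_of_mem_right ⟨hpos.le, habs.2⟩]
    exact ⟨abs_pos.2 (by linarith), abs_lt.2 ⟨by linarith [pi_pos], by linarith⟩⟩

/-- **Deck transport of channels**: `f ∈ χ ⇒ 𝟙_G · (f ∘ D) ∈ χ` (g19's argument: `G` is `D₄`-invariant and `D` commutes with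
`D₄` on it). [cite: RaghuKivelsonScalapino2010, §III (17)] -/
theorem klsl_inChannel_shift {χ : D4Irrep} {f : Momentum → ℝ} (h : InChannel χ f) :
    InChannel χ (klphGood.indicator (f ∘ klphShift)) := by
  funext k
  by_cases hk : k ∈ klphGood
  · have hfk := congrFun h (klphShift k)
    simp only [d4Project] at hfk ⊢
    rw [Set.indicator_of_mem hk, Function.comp_apply, ← hfk]
    congr 1
    refine Finset.sum_congr rfl fun γ _ => ?_
    rw [Set.indicator_of_mem ((d4Momentum_mem_klphGood_iff γ k).2 hk), Function.comp_apply, klphShift_d4Momentum γ hk]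
  · simp only [d4Project, Set.indicator_of_notMem hk]
    rw [Finset.sum_eq_zero (fun γ _ => ?_), mul_zero]
    rw [Set.indicator_of_notMem (fun h' => hk ((d4Momentum_mem_klphGood_iff γ k).1 h')), mul_zero]

/-! ### §15 The deck-odd part is invisible to the pairing form -/

/-- **The kernel annihilates deck-odd functions**: if `g ∘ D = -g` `σ'`-a.e. then `∫ Γ'(k, k') g(k') dσ'(k') = 0` for EVERY `k`
(substitute `k' ↦ D k'`, which preserves `σ'` and the kernel). [folklore] -/
theorem klsl_integral_kernel_odd (μ U : ℝ) (k : Momentum) {g : Momentum → ℝ}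
    (hg : ∀ᵐ k' ∂fermiCurveMeasure (squareDispersion 0 1) μ, g (klphShift k') = -g k') :
    ∫ k', kohnLuttingerKernel (squareDispersion 0 1) μ U k k' * g k' ∂fermiCurveMeasure (squareDispersion 0 1) μ = 0 := by
  have h1 := (klsl_measurePreserving_shift_nnn μ).integral_comp klph_measurableEmbedding_shift
    (fun k' => kohnLuttingerKernel (squareDispersion 0 1) μ U k k' * g k')
  have h2 : ∫ k', kohnLuttingerKernel (squareDispersion 0 1) μ U k (klphShift k') * g (klphShift k')
      ∂fermiCurveMeasure (squareDispersion 0 1) μ =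
      ∫ k', -(kohnLuttingerKernel (squareDispersion 0 1) μ U k k' * g k') ∂fermiCurveMeasure (squareDispersion 0 1) μ := by
    refine integral_congr_ae ?_
    filter_upwards [hg, ae_mem_fermiCurve (measurable_squareDispersion 0 1) μ] with k' hk' hF
    rw [klsl_kernel_nnn_shift_right μ U k hF.1, hk']
    ring
  rw [h2, integral_neg] at h1
  linarith

/-- `f ⊗ g ∈ L²(λ ⊗ λ)` for `f, g ∈ L²(λ)`. [folklore] -/
theorem klsl_memLp_two_tensor {α : Type*} [MeasurableSpace α] {ν : Measure α} [SFinite ν] {f g : α → ℝ}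
    (hf : MemLp f 2 ν) (hg : MemLp g 2 ν) : MemLp (fun z : α × α => f z.1 * g z.2) 2 (ν.prod ν) := by
  have hmeas : AEStronglyMeasurable (fun z : α × α => f z.1 * g z.2) (ν.prod ν) := hf.1.comp_fst.mul hg.1.comp_snd
  rw [memLp_two_iff_integrable_sq hmeas]
  have hf2 : Integrable (fun x => f x ^ 2) ν := (memLp_two_iff_integrable_sq hf.1).1 hf
  have hg2 : Integrable (fun x => g x ^ 2) ν := (memLp_two_iff_integrable_sq hg.1).1 hg
  refine (hf2.mul_prod hg2).congr (Filter.Eventually.of_forall fun z => ?_)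
  simp only
  ring

/-- **Bilinear Fubini**: `∫ f(x) (∫ M(x,y) g(y) dy) dx = ∫ M · (f ⊗ g) d(λ ⊗ λ)` for `f, g ∈ L²`, `M ∈ L²(λ ⊗ λ)`. [folklore] -/
theorem klsl_integral_bilinear_eq_prod {α : Type*} [MeasurableSpace α] {ν : Measure α} [SFinite ν] {f g : α → ℝ}
    {M : α × α → ℝ} (hf : MemLp f 2 ν) (hg : MemLp g 2 ν) (hM : MemLp M 2 (ν.prod ν)) :
    ∫ x, f x * ∫ y, M (x, y) * g y ∂ν ∂ν = ∫ z, M z * (f z.1 * g z.2) ∂(ν.prod ν) := by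
  have hint : Integrable (fun z : α × α => M z * (f z.1 * g z.2)) (ν.prod ν) :=
    hM.integrable_mul (klsl_memLp_two_tensor hf hg)
  rw [integral_prod _ hint]
  refine integral_congr_ae (Filter.Eventually.of_forall fun x => ?_)
  simp only
  rw [← integral_const_mul]
  refine integral_congr_ae (Filter.Eventually.of_forall fun y => ?_)
  ring

/-- **The pairing form of the pure `t'` band drops the deck-odd part**: if `f = e + o` with `e, o ∈ L²(σ')` and
`o ∘ D = -o` a.e., then `⟨f, Γ' f⟩ = ⟨e, Γ' e⟩` (`μ ∈ (-4, 0)`; the cross and odd–odd terms are integrals of `Γ' o = 0`,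
the `o ⊗ e` term by the symmetry of `Γ'`). [cite: RaghuKivelsonScalapino2010, §II (7)] -/
theorem klsl_pairingForm_even_odd {μ : ℝ} (hμ : μ ∈ Ioo (-4 : ℝ) 0) (U : ℝ) {f e o : Momentum → ℝ}
    (he : MemLp e 2 (fermiCurveMeasure (squareDispersion 0 1) μ)) (ho : MemLp o 2 (fermiCurveMeasure (squareDispersion 0 1) μ))
    (hfe : ∀ k, f k = e k + o k) (hodd : ∀ᵐ k ∂fermiCurveMeasure (squareDispersion 0 1) μ, o (klphShift k) = -o k) :
    pairingForm (squareDispersion 0 1) μ U f = pairingForm (squareDispersion 0 1) μ U e := by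
  haveI := klsl_isFiniteMeasure_nnn hμ
  have hK2 := klhs_frame_memLp_kernel U (klsl_kernelHS_nnn hμ)
  have hf : MemLp f 2 (fermiCurveMeasure (squareDispersion 0 1) μ) := by
    have : f = fun k => e k + o k := funext hfe
    rw [this]; exact he.add ho
  have hPf := integral_mul_integral_mul_eq_integral_prod (M := fun z : Momentum × Momentum =>
    kohnLuttingerKernel (squareDispersion 0 1) μ U z.1 z.2) hf hK2
  have hPe := integral_mul_integral_mul_eq_integral_prod (M := fun z : Momentum × Momentum =>
    kohnLuttingerKernel (squareDispersion 0 1) μ U z.1 z.2) he hK2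
  unfold pairingForm
  rw [hPf, hPe]
  -- the four pieces
  have iee : Integrable (fun z : Momentum × Momentum => kohnLuttingerKernel (squareDispersion 0 1) μ U z.1 z.2 * (e z.1 * e z.2))
      ((fermiCurveMeasure (squareDispersion 0 1) μ).prod (fermiCurveMeasure (squareDispersion 0 1) μ)) :=
    hK2.integrable_mul (klsl_memLp_two_tensor he he)
  have ieo : Integrable (fun z : Momentum × Momentum => kohnLuttingerKernel (squareDispersion 0 1) μ U z.1 z.2 * (e z.1 * o z.2))
      ((fermiCurveMeasure (squareDispersion 0 1) μ).prod (fermiCurveMeasure (squareDispersion 0 1) μ)) :=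
    hK2.integrable_mul (klsl_memLp_two_tensor he ho)
  have ioe : Integrable (fun z : Momentum × Momentum => kohnLuttingerKernel (squareDispersion 0 1) μ U z.1 z.2 * (o z.1 * e z.2))
      ((fermiCurveMeasure (squareDispersion 0 1) μ).prod (fermiCurveMeasure (squareDispersion 0 1) μ)) :=
    hK2.integrable_mul (klsl_memLp_two_tensor ho he)
  have ioo : Integrable (fun z : Momentum × Momentum => kohnLuttingerKernel (squareDispersion 0 1) μ U z.1 z.2 * (o z.1 * o z.2))
      ((fermiCurveMeasure (squareDispersion 0 1) μ).prod (fermiCurveMeasure (squareDispersion 0 1) μ)) :=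
    hK2.integrable_mul (klsl_memLp_two_tensor ho ho)
  have hsplit : ∀ z : Momentum × Momentum,
      kohnLuttingerKernel (squareDispersion 0 1) μ U z.1 z.2 * (f z.1 * f z.2) =
        (kohnLuttingerKernel (squareDispersion 0 1) μ U z.1 z.2 * (e z.1 * e z.2) +
          kohnLuttingerKernel (squareDispersion 0 1) μ U z.1 z.2 * (e z.1 * o z.2)) +
        (kohnLuttingerKernel (squareDispersion 0 1) μ U z.1 z.2 * (o z.1 * e z.2) +
          kohnLuttingerKernel (squareDispersion 0 1) μ U z.1 z.2 * (o z.1 * o z.2)) := by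
    intro z; rw [hfe z.1, hfe z.2]; ring
  have i12 : Integrable (fun z : Momentum × Momentum =>
      kohnLuttingerKernel (squareDispersion 0 1) μ U z.1 z.2 * (e z.1 * e z.2) +
        kohnLuttingerKernel (squareDispersion 0 1) μ U z.1 z.2 * (e z.1 * o z.2))
      ((fermiCurveMeasure (squareDispersion 0 1) μ).prod (fermiCurveMeasure (squareDispersion 0 1) μ)) := iee.add ieo
  have i34 : Integrable (fun z : Momentum × Momentum =>
      kohnLuttingerKernel (squareDispersion 0 1) μ U z.1 z.2 * (o z.1 * e z.2) +
        kohnLuttingerKernel (squareDispersion 0 1) μ U z.1 z.2 * (o z.1 * o z.2))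
      ((fermiCurveMeasure (squareDispersion 0 1) μ).prod (fermiCurveMeasure (squareDispersion 0 1) μ)) := ioe.add ioo
  rw [integral_congr_ae (Filter.Eventually.of_forall hsplit), integral_add i12 i34,
    integral_add iee ieo, integral_add ioe ioo]
  -- `e ⊗ o` and `o ⊗ o`: the inner integral against `o` vanishes
  have heo : ∫ z, kohnLuttingerKernel (squareDispersion 0 1) μ U z.1 z.2 * (e z.1 * o z.2)
      ∂(fermiCurveMeasure (squareDispersion 0 1) μ).prod (fermiCurveMeasure (squareDispersion 0 1) μ) = 0 := by
    rw [← klsl_integral_bilinear_eq_prod (M := fun z : Momentum × Momentum =>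
      kohnLuttingerKernel (squareDispersion 0 1) μ U z.1 z.2) he ho hK2]
    simp only [klsl_integral_kernel_odd μ U _ hodd, mul_zero, integral_zero]
  have hoo : ∫ z, kohnLuttingerKernel (squareDispersion 0 1) μ U z.1 z.2 * (o z.1 * o z.2)
      ∂(fermiCurveMeasure (squareDispersion 0 1) μ).prod (fermiCurveMeasure (squareDispersion 0 1) μ) = 0 := by
    rw [← klsl_integral_bilinear_eq_prod (M := fun z : Momentum × Momentum =>
      kohnLuttingerKernel (squareDispersion 0 1) μ U z.1 z.2) ho ho hK2]
    simp only [klsl_integral_kernel_odd μ U _ hodd, mul_zero, integral_zero]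
  -- `o ⊗ e`: swap the variables and use the symmetry of the kernel
  have hoe : ∫ z, kohnLuttingerKernel (squareDispersion 0 1) μ U z.1 z.2 * (o z.1 * e z.2)
      ∂(fermiCurveMeasure (squareDispersion 0 1) μ).prod (fermiCurveMeasure (squareDispersion 0 1) μ) = 0 := by
    have hswap := integral_prod_swap (μ := fermiCurveMeasure (squareDispersion 0 1) μ)
      (ν := fermiCurveMeasure (squareDispersion 0 1) μ)
      (fun z : Momentum × Momentum => kohnLuttingerKernel (squareDispersion 0 1) μ U z.1 z.2 * (e z.1 * o z.2))
    have hcongr : ∫ z, kohnLuttingerKernel (squareDispersion 0 1) μ U z.1 z.2 * (o z.1 * e z.2)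
        ∂(fermiCurveMeasure (squareDispersion 0 1) μ).prod (fermiCurveMeasure (squareDispersion 0 1) μ) =
        ∫ z, (fun w : Momentum × Momentum => kohnLuttingerKernel (squareDispersion 0 1) μ U w.1 w.2 * (e w.1 * o w.2)) z.swap
        ∂(fermiCurveMeasure (squareDispersion 0 1) μ).prod (fermiCurveMeasure (squareDispersion 0 1) μ) := by
      refine integral_congr_ae (Filter.Eventually.of_forall fun z => ?_)
      simp only [Prod.fst_swap, Prod.snd_swap, kohnLuttingerKernel_comm (squareDispersion 0 1) μ U z.2 z.1]
      ring
    rw [hcongr, hswap, heo]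
  rw [heo, hoe, hoo]
  ring

end Summit.HubbardSuperconductivity.HubbardSuperconductivity.Theorems

end
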